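import Summits.QuantumFields.YangMills.Theses.BalabanUVNodes
import Literature.MathematicalPhysics.QuantumFieldTheory.Balaban1983to89.Node00.N23Dossier

/-!
# BalabanLadder ∕ UV — what Track A's four items deliver AT THE PINNED STAGE-11 RECORD, the projection to the spine leaf
# `BalabanLadder.UV`, the T⁴ apex there (∀-, ∃- and law-readings), and the rev-0 asides as consequences of the rev-6 items

OS-ASSEMBLY BOOKKEEPING (cell `ym-fleet`, seat `ym-osasm-p1`, director-ym R136 (iii); `--supports stmt-QuantumFields-19351` = the spine
crux `Summit.QuantumFields.YangMills.Theses.BalabanLadder.UV`, binder `hUV` of `BalabanLadder.closes`).  COUNT-NEUTRAL; nothing of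
Bałaban's is asserted; every hypothesis is an OPEN route item used by modus ponens; 0 `sorry`, 0 `def`, standard axioms.

WHY THIS FILE.  Since rev 6 (T-DAY 2026-08-26) the detail route `route-QuantumFields-BalabanUVNodes` decides the spine leaf from FOUR items
over NODE 00's Stage-11 record-of-record `Node00.IsRecordOfRecord₁₁C F 2 D w` — K0 `Record11Inhabited` (stmt-QuantumFields-19673), K1
`StabilityBAtRecordR11e` (19674), K2 `EndpointGivenBR11` (19675), K3 `SpineGivenEndpointR11` (19676) — and its deciding theorem
`BalabanUVNodes.closes` PROJECTS K1's record to the Stage-0 datum (`Node00.isDatumOfRecord₀_of_isRecordOfRecord₁₁C`) before concluding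
`BalabanLadder.UV` (Stage 0 pins the averaging maps only).  The spine's consumers of `hUV` (`UVSeamRec`'s `stub_ceilings`, the E1 restate
of `UV` «over Node00» announced for the definer window, judge flag `line-under-restate:UV`) want the content BEFORE that projection: the
datum IS Bałaban's `datumOfRecord₁₁ F 2 θ h` for admissible θ with its provisos, the world is bound to its construction, AND (B), the
`K ≥ 1` coupling window, endpoint existence and the hybrid-NE7 spine hold there.  This module states that package once (§1), projects it
to the leaf BY NAME (§2 — the D-0061 identity: same binders, same conclusion as `BalabanUVNodes.closes`), reads the T⁴ apex at the
pinned record in its three currencies (§3), and records that the rev-0 items of the detail route (now ASIDES: `StabilityBAtRecord` 19183,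
`EndpointGivenB` 19181, `SpineGivenEndpoint` 19182 — the stubs of the v1 skeleton registered on 19351, which no longer elaborates against
rev 6) are CONSEQUENCES of the rev-6 four (§4): the restate lost nothing a Stage-0 consumer keyed on.

HONEST FRAMING.  Knits of a CONDITIONAL chain: K0–K3 are open (typed 28∕28, discharged 5∕28 at node level); one finite four-torus
programme at fixed ε per family; NOT infinite volume, NOT OS reconstruction on ℝ⁴, NOT a mass gap, NOT Clay; NOT the Y2 bridge's
`UV G r a := MomentBounds6 G r a` (that junction is the spine item `UVSeamRec`, stmt-QuantumFields-20043).
-/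

namespace Summit.QuantumFields.YangMills.Cruxes.UV.NodesRecord11

open Literature.MathematicalPhysics.QuantumFieldTheory.Balaban1983to89
open Literature.MathematicalPhysics.QuantumFieldTheory.Balaban1983to89.T4Continuum
open Literature.MathematicalPhysics.QuantumFieldTheory.Balaban1983to89.T4ContinuumYM4Torus
open Summit.QuantumFields.YangMills.Theses.BalabanUVNodes (Record11Inhabited StabilityBAtRecordR11e EndpointGivenBR11
  SpineGivenEndpointR11 StabilityBAtRecord EndpointGivenB SpineGivenEndpoint)

/-! ## §1 Track A's output AT THE PINNED RECORD (before the Stage-0 projection) -/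

/-- **THE STAGE-11 UV PACKAGE FROM THE FOUR ITEMS**: on every four-torus family some Stage-11 record-of-record `(D, w)` carries (B) as
printed, the non-vacuity window with `K ≥ 1`, endpoint existence of its coupling flow and the hybrid-NE7 spine under it — K1's record
(given K0's inhabitation), fed to K2 and K3 AT THAT RECORD.  This is the term of `BalabanUVNodes.closes` one line before it forgets `w`
and the pin. -/
theorem uvAtRecord11_of_nodes (h0 : Record11Inhabited) (h1 : StabilityBAtRecordR11e) (h2 : EndpointGivenBR11)
    (h3 : SpineGivenEndpointR11) (F : T4Family) :
    ∃ (D : FiniteEpsData F (Matrix.specialUnitaryGroup (Fin 2) ℂ)) (w : DagBinding.WorldP), Node00.IsRecordOfRecord₁₁C F 2 D w ∧ B16.EndStatementBPrinted D.C ∧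
      (∃ γ₁ : ℝ, 0 < γ₁ ∧ ∀ γ : ℝ, 0 < γ → γ ≤ γ₁ → ∃ P : B12.RunParams, 1 ≤ P.K ∧ (D.C P).flow.InInterval γ P.K) ∧
      DagBinding.EndpointExistence D.C.toB12 ∧
      T4ApexHybrid.HybridNE7Under D (DagBinding.EndpointExistence D.C.toB12) := by
  obtain ⟨D, w, hR, hB, hwin⟩ := h1 F (h0 F)
  have hEnd : DagBinding.EndpointExistence D.C.toB12 := h2 F D w hR hB hwin
  exact ⟨D, w, hR, hB, hwin, hEnd, h3 F D w hR hB hEnd⟩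

/-- The same package read through Bałaban's PARAMETERS: on every family some admissible Stage-11 parameter tuple `θ` satisfying its
displayed provisos, whose datum of record `datumOfRecord₁₁ F 2 θ hP` carries (B), endpoint existence and the spine (the record predicate
certifies θ: `Node00.exists_provisos_of_isRecordOfRecord₁₁C`). -/
theorem uvAtParams11_of_nodes (h0 : Record11Inhabited) (h1 : StabilityBAtRecordR11e) (h2 : EndpointGivenBR11)
    (h3 : SpineGivenEndpointR11) (F : T4Family) :
    ∃ (θ : Node00.Stage11Params F 2) (hP : θ.Provisos₁₁), θ.Admissible ∧
      B16.EndStatementBPrinted (Node00.datumOfRecord₁₁ F 2 θ hP).C ∧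
      DagBinding.EndpointExistence (Node00.datumOfRecord₁₁ F 2 θ hP).C.toB12 ∧
      T4ApexHybrid.HybridNE7Under (Node00.datumOfRecord₁₁ F 2 θ hP)
        (DagBinding.EndpointExistence (Node00.datumOfRecord₁₁ F 2 θ hP).C.toB12) := by
  obtain ⟨D, w, hR, hB, -, hEnd, hNE⟩ := uvAtRecord11_of_nodes h0 h1 h2 h3 F
  obtain ⟨θ, hP, hθ, rfl⟩ := Node00.exists_provisos_of_isRecordOfRecord₁₁C hR
  exact ⟨θ, hP, hθ, hB, hEnd, hNE⟩

/-! ## §2 The projection to the spine leaf BY NAME (D-0061 identity) -/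

/-- **ANY Stage-11 UV package projects to the spine leaf** `BalabanLadder.UV` (Stage 0 = `D.av` is the averaging of record, by
`Node00.isDatumOfRecord₀_of_isRecordOfRecord₁₁C`); the window is not needed. -/
theorem ladderUV_of_uvAtRecord11
    (h : ∀ F : T4Family, ∃ (D : FiniteEpsData F (Matrix.specialUnitaryGroup (Fin 2) ℂ)) (w : DagBinding.WorldP), Node00.IsRecordOfRecord₁₁C F 2 D w ∧
      B16.EndStatementBPrinted D.C ∧ DagBinding.EndpointExistence D.C.toB12 ∧
      T4ApexHybrid.HybridNE7Under D (DagBinding.EndpointExistence D.C.toB12)) :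
    Summit.QuantumFields.YangMills.Theses.BalabanLadder.UV := by
  intro F
  obtain ⟨D, w, hR, hB, hEnd, hNE⟩ := h F
  exact ⟨D, Node00.isDatumOfRecord₀_of_isRecordOfRecord₁₁C hR, hB, hEnd, hNE⟩

/-- **THE SPINE BINDER `hUV` FROM TRACK A's FOUR ITEMS** — hypotheses = the four `route_item`s of `route-QuantumFields-BalabanUVNodes`
BY NAME, conclusion = `Summit.QuantumFields.YangMills.Theses.BalabanLadder.UV` BY NAME: the type of the detail route's deciding theorem
`BalabanUVNodes.closes` (D-0061 `closes_target`), re-derived through §1 (same term up to proof irrelevance). -/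
theorem ladderUV_of_nodes (h0 : Record11Inhabited) (h1 : StabilityBAtRecordR11e) (h2 : EndpointGivenBR11)
    (h3 : SpineGivenEndpointR11) : Summit.QuantumFields.YangMills.Theses.BalabanLadder.UV :=
  ladderUV_of_uvAtRecord11 fun F => by
    obtain ⟨D, w, hR, hB, -, hEnd, hNE⟩ := uvAtRecord11_of_nodes h0 h1 h2 h3 F
    exact ⟨D, w, hR, hB, hEnd, hNE⟩

/-- Kernel witness of the identity: the detail route's own `closes` has literally the same binders and the same conclusion. -/
theorem ladderUV_of_nodes_eq_closes :
    @ladderUV_of_nodes = @Summit.QuantumFields.YangMills.Theses.BalabanUVNodes.closes := rfl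

/-! ## §3 The T⁴ apex AT THE PINNED RECORD, in its three currencies -/

/-- **THE APEX AT THE STAGE-11 RECORD, ∀- and ∃-readings**: on every family some Stage-11 record-of-record with endpoint existence AT
WHICH `ContinuumYM4Torus D ∧ ContinuumYM4TorusE D` — for all small γ, g and every (resp. some) tuned bare-coupling sequence the joint
expectations of the unit-scale averaged loop variables converge as ε → 0, limit points agree, are reflection positive and torus covariant
(`T4ContinuumYM4Torus.continuumYM4_torus_of_endpointExistence_nonvacuous` with B1 by `Node00.isPrintedAveraged_of_isRecordOfRecord₁₁C`). -/
theorem apexAtRecord11_of_nodes (h0 : Record11Inhabited) (h1 : StabilityBAtRecordR11e) (h2 : EndpointGivenBR11)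
    (h3 : SpineGivenEndpointR11) (F : T4Family) :
    ∃ (D : FiniteEpsData F (Matrix.specialUnitaryGroup (Fin 2) ℂ)) (w : DagBinding.WorldP), Node00.IsRecordOfRecord₁₁C F 2 D w ∧
      DagBinding.EndpointExistence D.C.toB12 ∧ ContinuumYM4Torus D ∧ ContinuumYM4TorusE D := by
  obtain ⟨D, w, hR, hB, -, hEnd, hNE⟩ := uvAtRecord11_of_nodes h0 h1 h2 h3 F
  exact ⟨D, w, hR, hEnd, continuumYM4_torus_of_endpointExistence_nonvacuous D
    (Node00.isPrintedAveraged_of_isRecordOfRecord₁₁C hR) hB hEnd hNE⟩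

/-- **THE APEX AT THE STAGE-11 RECORD, LAW-READING**: on every family some Stage-11 record-of-record, with its (measurable) averaging of
record, AT WHICH `ContinuumYM4TorusLaw D hM` — for all small γ, g and every tuned bare-coupling sequence exactly ONE Borel probability law
on the loop cube is the full-sequence weak limit of the laws of the unit-scale averaged loop variables, OS-positive on every strict cone
and invariant under the unit-torus isometries (`Node00.continuumYM4TorusLaw_of_isDatumOfRecord₀`). -/
theorem lawAtRecord11_of_nodes (h0 : Record11Inhabited) (h1 : StabilityBAtRecordR11e) (h2 : EndpointGivenBR11)
    (h3 : SpineGivenEndpointR11) (F : T4Family) :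
    ∃ (D : FiniteEpsData F (Matrix.specialUnitaryGroup (Fin 2) ℂ)) (w : DagBinding.WorldP) (hM : D.AvgMeasurable), Node00.IsRecordOfRecord₁₁C F 2 D w ∧
      DagBinding.EndpointExistence D.C.toB12 ∧ ContinuumYM4TorusLaw D hM := by
  obtain ⟨D, w, hR, hB, -, hEnd, hNE⟩ := uvAtRecord11_of_nodes h0 h1 h2 h3 F
  exact ⟨D, w, _, hR, hEnd,
    Node00.continuumYM4TorusLaw_of_isDatumOfRecord₀ (Node00.isDatumOfRecord₀_of_isRecordOfRecord₁₁C hR) hB hEnd hNE⟩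

/-- The apex read through Bałaban's parameters: some admissible θ with its provisos whose datum of record HAS the continuum limit in both
tuned-sequence readings (`Node00.continuumYM4Torus_datumOfRecord₁₁` for the ∀-form). -/
theorem apexAtParams11_of_nodes (h0 : Record11Inhabited) (h1 : StabilityBAtRecordR11e) (h2 : EndpointGivenBR11)
    (h3 : SpineGivenEndpointR11) (F : T4Family) :
    ∃ (θ : Node00.Stage11Params F 2) (hP : θ.Provisos₁₁), θ.Admissible ∧
      ContinuumYM4Torus (Node00.datumOfRecord₁₁ F 2 θ hP) ∧ ContinuumYM4TorusE (Node00.datumOfRecord₁₁ F 2 θ hP) := by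
  obtain ⟨θ, hP, hθ, hB, hEnd, hNE⟩ := uvAtParams11_of_nodes h0 h1 h2 h3 F
  have h := Node00.continuumYM4Torus_datumOfRecord₁₁ F 2 θ hP hB hEnd hNE
  exact ⟨θ, hP, hθ, h, continuumYM4TorusE_of_endpoint hEnd h⟩

/-! ## §4 The rev-0 ASIDES of the detail route are consequences of the rev-6 items (the restate lost nothing at Stage 0) -/

/-- K0 ∧ K1 ⇒ the rev-0 aside `StabilityBAtRecord` (stmt-QuantumFields-19183): (B) with the coupling window at a Stage-0 datum of record
(K1's `1 ≤ P.K` clause is dropped). -/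
theorem stabilityBAtRecord_of_nodes (h0 : Record11Inhabited) (h1 : StabilityBAtRecordR11e) : StabilityBAtRecord := by
  intro F
  obtain ⟨D, w, hR, hB, γ₁, hγ₁, hwin⟩ := h1 F (h0 F)
  refine ⟨D, Node00.isDatumOfRecord₀_of_isRecordOfRecord₁₁C hR, hB, γ₁, hγ₁, fun γ hγ hγle => ?_⟩
  obtain ⟨P, -, hP⟩ := hwin γ hγ hγle
  exact ⟨P, hP⟩

/-- K0 ∧ K1 ∧ K2 ⇒ the rev-0 aside `EndpointGivenB` (stmt-QuantumFields-19181): its consequent holds outright (its Stage-0 antecedent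
is not used — the rev-6 items supply (B), the window and END at the pinned record). -/
theorem endpointGivenB_of_nodes (h0 : Record11Inhabited) (h1 : StabilityBAtRecordR11e) (h2 : EndpointGivenBR11) :
    EndpointGivenB := by
  intro F _
  obtain ⟨D, w, hR, hB, hwin⟩ := h1 F (h0 F)
  exact ⟨D, Node00.isDatumOfRecord₀_of_isRecordOfRecord₁₁C hR, hB, h2 F D w hR hB hwin⟩

/-- K0 ∧ K1 ∧ K2 ∧ K3 ⇒ the rev-0 aside `SpineGivenEndpoint` (stmt-QuantumFields-19182): its consequent at `F` is the body of
`BalabanLadder.UV` at `F` (antecedent unused). -/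
theorem spineGivenEndpoint_of_nodes (h0 : Record11Inhabited) (h1 : StabilityBAtRecordR11e) (h2 : EndpointGivenBR11)
    (h3 : SpineGivenEndpointR11) : SpineGivenEndpoint :=
  fun F _ => ladderUV_of_nodes h0 h1 h2 h3 F

end Summit.QuantumFields.YangMills.Cruxes.UV.NodesRecord11
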